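import Summits.AnomalousDissipation.AnomalousDissipation.Theorems.SolenoidalFractalHomogenisationLagrangianStepFrameToEulerianKinematics
import HarnessLib

/-!
# K1L_D (stmt-AnomalousDissipation-27980), `stub_Z7_alphaBeta` α-provider, (T1) sub-target (C6) of memos L15/L16: FRAME ⇒ EULERIAN for
# weak solutions, at cell time (helper; `--supports … --as helper`; lead-k1l-onelevel-p1 g5)

Piece `[r₀, t]` of a closed refresh window (`r₀ = jR ≤ t ≤ jR + R`), cell clock `a = a (m+1)`, base `σ₁ ∈ [0, a(t−r₀)]`, frame horizon
`T = a(t−r₀) − σ₁`, flow times `t′(τ) = r₀ + (σ₁+τ)/a`.  GIVEN a distorted weak solution `w` (labels = positions at the reset `r₀`) along the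
frame carrier `τ ↦ bc(σ₁+τ)` and the CLAMPED frame curve `τ ↦ frameG E m (r₀ + clamp(σ₁+τ)/a) r₀` from a datum `φ`, and an Eulerian
(cell-time) carrier `Bt` with the POINTWISE RELATION `∇X · bc(σ₁+τ) = (Bt τ − (1/a) b_{≤m}(t′)) ∘ X` on `(0,T)` (for the true member this is
`IsInserted`, for the coarse member `bc = 0`, `Bt = (1/a) b_{≤m}`), **`isWeakTensorPassiveVectorOn_read`** proves that the Eulerian reading
`u τ x := w τ (X m r₀ (t′ τ) x)` is a weak solution of the FLAT class on `(0,T)` with carrier `Bt`, the same tensor, and datum `φ ∘ X m r₀ (r₀+σ₁/a)`.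
The weak identity is transferred test by test: an Eulerian test `Φ` is read as the frame test `Ψ τ = Φ τ ∘ X m (r₀ + clamp(σ₁+τ)/a) r₀`
(admissible by `…FrameTestLipschitz`); pointwise on `(0,T)`, `∂_τΨ = (∂_tΦ + (1/a)(b_{≤m}·∇)Φ) ∘ X` ((C3)), `(bc·∇)Ψ = ((Bt − (1/a)b_{≤m})·∇)Φ ∘ X`
(chain rule + the relation), `𝓛^{G,*}Ψ = (𝓛_𝔸^*Φ) ∘ X` ((C2), closed window), so the frame integrand is the Eulerian integrand composed with
the volume-preserving `X`; the datum terms agree by the same substitution.  Time rescaling to physical time is `comp_mul_time` (next file).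
NOT a proof of the stub, of the crux, or of AD; rung F-D1.A0.
-/

set_option linter.dupNamespace false  -- the summit-side namespace `Summit.AnomalousDissipation.AnomalousDissipation.…` repeats a component by design (D-0017)

noncomputable section

namespace Summit.AnomalousDissipation.AnomalousDissipation.Theorems.SolenoidalFractalHomogenisation.LagrangianStep.FrameConj

open Set Function Filter MeasureTheory Topology
open scoped NNReal ENNReal InnerProductSpace ContDiff
open Literature.Analysis Literature.Analysis.FunctionSpaces Literature.Analysis.FunctionSpaces.Torus
open Literature.Analysis.FluidPDE Literature.Analysis.FluidPDE.LatticeShear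
open Literature.Analysis.FluidPDE.LatticeShear (LagrangianLatticeCarrier)
open Summit.AnomalousDissipation.AnomalousDissipation.Theorems.SolenoidalFractalHomogenisation.LagrangianCarrier (fderiv_comp_displacement)

variable {k : ℕ}

/-! ## §1 Pointwise identities on the open piece -/

/-- On `(0, T)`, `T = a(t−r₀) − σ₁`, the clamp is the identity. -/
theorem clamp_eq_of_mem_Ioo (E : LagrangianLatticeCarrier k) (m : ℕ) {r₀ t σ₁ T τ : ℝ} (hσ₁ : 0 ≤ σ₁)
    (hT : T = E.a (m + 1) * (t - r₀) - σ₁) (hτ : τ ∈ Ioo 0 T) :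
    max 0 (min (σ₁ + τ) (E.a (m + 1) * (t - r₀))) = σ₁ + τ := by
  rw [min_eq_left (by rw [hT] at hτ; linarith [hτ.2]), max_eq_right (by linarith [hτ.1])]

/-- **The frame transport term is the Eulerian one composed with the flow**: `(v·∇_y)(Φ ∘ X)(y) = ((∇X(y) v)·∇_x Φ)(X y)`. -/
theorem convect_comp_X (E : LagrangianLatticeCarrier k) (hR : E.LevelRegular) (m : ℕ) (t' s : ℝ)
    {Φ : UnitAddTorus (Fin 3) → EuclideanSpace ℝ (Fin 3)} (hΦ : IsSmooth Φ) (v : UnitAddTorus (Fin 3) → EuclideanSpace ℝ (Fin 3))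
    (y : UnitAddTorus (Fin 3)) :
    Torus.convect v (fun x => Φ (E.X m t' s x)) y = Torus.fderiv Φ (E.X m t' s y) (E.flowDeriv m t' s y (v y)) := by
  unfold Torus.convect
  have h := fderiv_comp_displacement hΦ (hR.isSmooth_disp m t' s) y
  rw [flowDeriv_eq_id_add_fderiv]
  exact congrArg (fun L : EuclideanSpace ℝ (Fin 3) →L[ℝ] EuclideanSpace ℝ (Fin 3) => L (v y)) h

/-- **The time derivative of the frame test on the open piece** ((C3) with the clamp removed locally). -/
theorem timeDeriv_frameTest (E : LagrangianLatticeCarrier k) (hR : E.LevelRegular) {m : ℕ} (hF : E.IsFlow m) {r₀ t σ₁ T : ℝ}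
    (hσ₁ : 0 ≤ σ₁) (hT : T = E.a (m + 1) * (t - r₀) - σ₁) {Φ : ℝ → UnitAddTorus (Fin 3) → EuclideanSpace ℝ (Fin 3)}
    (hΦ : ContDiff ℝ 1 (stLift Φ)) {τ : ℝ} (hτ : τ ∈ Ioo 0 T) (y : UnitAddTorus (Fin 3)) :
    Torus.timeDeriv (fun τ' y => Φ τ' (E.X m (r₀ + max 0 (min (σ₁ + τ') (E.a (m + 1) * (t - r₀))) / E.a (m + 1)) r₀ y)) τ y
      = Torus.timeDeriv Φ τ (E.X m (r₀ + (σ₁ + τ) / E.a (m + 1)) r₀ y) +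
        (1 / E.a (m + 1)) • Torus.convect (E.partialSum m (r₀ + (σ₁ + τ) / E.a (m + 1))) (Φ τ)
          (E.X m (r₀ + (σ₁ + τ) / E.a (m + 1)) r₀ y) := by
  have ha : E.a (m + 1) ≠ 0 := (E.a_pos (m + 1)).ne'
  -- the honest composite along the affine clock and its derivative
  have hderiv := (hasDerivAt_test_comp_flow E hR hF r₀ (r₀ + σ₁ / E.a (m + 1)) (1 / E.a (m + 1)) hΦ τ y).deriv
  have e : r₀ + σ₁ / E.a (m + 1) + 1 / E.a (m + 1) * τ = r₀ + (σ₁ + τ) / E.a (m + 1) := by field_simp; ring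
  rw [e] at hderiv
  -- the frame test agrees with the honest composite near `τ`
  have hloc : (fun τ' => Φ τ' (E.X m (r₀ + max 0 (min (σ₁ + τ') (E.a (m + 1) * (t - r₀))) / E.a (m + 1)) r₀ y))
      =ᶠ[𝓝 τ] fun τ' => Φ τ' (E.X m (r₀ + σ₁ / E.a (m + 1) + 1 / E.a (m + 1) * τ') r₀ y) := by
    filter_upwards [Ioo_mem_nhds hτ.1 hτ.2] with τ' hτ'
    rw [clamp_eq_of_mem_Ioo E m hσ₁ hT hτ']
    have e' : r₀ + (σ₁ + τ') / E.a (m + 1) = r₀ + σ₁ / E.a (m + 1) + 1 / E.a (m + 1) * τ' := by field_simp; ring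
    rw [e']
  unfold Torus.timeDeriv
  rw [hloc.deriv_eq]
  exact hderiv

/-! ## §2 Frame ⇒ Eulerian at cell time -/

/-- **(C6) FRAME ⇒ EULERIAN for weak solutions, cell time.**  See the module docstring.  Hypotheses: the closed piece `[jR, t]`; the base
`σ₁ ∈ [0, a(t−jR)]` and horizon `T = a(t−jR) − σ₁`; a continuous, weakly solenoidal Eulerian carrier `Bt` related to the frame carrier `bc`
by `∇X · bc(σ₁+τ) = (Bt τ − (1/a) b_{≤m}(t′τ)) ∘ X` on `(0,T)`; a distorted weak solution `w` from `φ ∈ L²` along the clamped curve. -/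
theorem isWeakTensorPassiveVectorOn_read (E : LagrangianLatticeCarrier k) (hR : E.LevelRegular) {m : ℕ} (hF : E.IsFlow m) (j : ℤ)
    {t σ₁ T : ℝ} (hjt : (j : ℝ) * E.refresh (m + 1) ≤ t) (htR : t ≤ (j : ℝ) * E.refresh (m + 1) + E.refresh (m + 1))
    (hσ₁ : 0 ≤ σ₁) (hσ₁T : σ₁ ≤ E.a (m + 1) * (t - (j : ℝ) * E.refresh (m + 1)))
    (hT : T = E.a (m + 1) * (t - (j : ℝ) * E.refresh (m + 1)) - σ₁)
    {𝔸c : FluidPDE.Torus.Visc4 (Fin 3)} {bc Bt : ℝ → UnitAddTorus (Fin 3) → EuclideanSpace ℝ (Fin 3)}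
    (hBt : Continuous (uncurry Bt)) (hBtdiv : ∀ τ, Torus.IsWeaklyDivFree (Bt τ))
    (hRB : ∀ τ ∈ Ioo 0 T, ∀ y,
      E.flowDeriv m ((j : ℝ) * E.refresh (m + 1) + (σ₁ + τ) / E.a (m + 1)) ((j : ℝ) * E.refresh (m + 1)) y (bc (σ₁ + τ) y)
        = Bt τ (E.X m ((j : ℝ) * E.refresh (m + 1) + (σ₁ + τ) / E.a (m + 1)) ((j : ℝ) * E.refresh (m + 1)) y)
          - (1 / E.a (m + 1)) • E.partialSum m ((j : ℝ) * E.refresh (m + 1) + (σ₁ + τ) / E.a (m + 1))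
              (E.X m ((j : ℝ) * E.refresh (m + 1) + (σ₁ + τ) / E.a (m + 1)) ((j : ℝ) * E.refresh (m + 1)) y))
    {φ : UnitAddTorus (Fin 3) → EuclideanSpace ℝ (Fin 3)} (hφ : MemLp φ 2 volume)
    {w : ℝ → UnitAddTorus (Fin 3) → EuclideanSpace ℝ (Fin 3)}
    (hw : FluidPDE.Torus.IsWeakTensorPassiveVectorDistortedOn 0 T 𝔸c (fun τ => bc (σ₁ + τ))
      (fun τ y => frameG E m ((j : ℝ) * E.refresh (m + 1) +
        max 0 (min (σ₁ + τ) (E.a (m + 1) * (t - (j : ℝ) * E.refresh (m + 1)))) / E.a (m + 1)) ((j : ℝ) * E.refresh (m + 1)) y) φ w) :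
    FluidPDE.Torus.IsWeakTensorPassiveVectorOn 0 T 𝔸c Bt
      (φ ∘ E.X m ((j : ℝ) * E.refresh (m + 1)) ((j : ℝ) * E.refresh (m + 1) + σ₁ / E.a (m + 1)))
      (fun τ x => w τ (E.X m ((j : ℝ) * E.refresh (m + 1)) ((j : ℝ) * E.refresh (m + 1) + (σ₁ + τ) / E.a (m + 1)) x)) := by
  have ha : 0 < E.a (m + 1) := E.a_pos (m + 1)
  have ha' : E.a (m + 1) ≠ 0 := ha.ne'
  have hθ : Continuous fun τ : ℝ => ((j : ℝ) * E.refresh (m + 1)) + (σ₁ + τ) / E.a (m + 1) := by fun_prop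
  -- inverse pairs of flow maps
  have hXX : ∀ (t'' : ℝ) (y : UnitAddTorus (Fin 3)), E.X m ((j : ℝ) * E.refresh (m + 1)) t'' (E.X m t'' ((j : ℝ) * E.refresh (m + 1)) y) = y := fun t'' y => by
    have h := congrFun (hR.X_comp_X m ((j : ℝ) * E.refresh (m + 1)) t'' ((j : ℝ) * E.refresh (m + 1))) y
    rw [Function.comp_apply, hR.X_self m ((j : ℝ) * E.refresh (m + 1))] at h
    exact h
  -- a uniform bound for the Eulerian carrier on `[0,T] × 𝕋³`
  obtain ⟨CB, hCB'⟩ := ((isCompact_Icc : IsCompact (Icc (0 : ℝ) T)).prod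
    (isCompact_univ : IsCompact (univ : Set (UnitAddTorus (Fin 3))))).exists_bound_of_continuousOn hBt.continuousOn
  have hCB : ∀ τ ∈ Icc (0 : ℝ) T, ∀ x, ‖Bt τ x‖ ≤ CB := fun τ hτ x => hCB' (τ, x) (mk_mem_prod hτ (mem_univ _))
  obtain ⟨C, hC⟩ := hw.ae_lintegral_sq_le
  have hslice : ∀ᵐ τ ∂(volume.restrict (Ioo 0 T)), AEStronglyMeasurable (w τ) volume :=
    hw.ae_aestronglyMeasurable_slice.mono fun τ h => h.1
  have hsq : ∀ᵐ τ ∂(volume.restrict (Ioo 0 T)), ∫⁻ x, ‖w τ (E.X m ((j : ℝ) * E.refresh (m + 1)) (((j : ℝ) * E.refresh (m + 1)) + (σ₁ + τ) / E.a (m + 1)) x)‖ₑ ^ 2 ≤ C :=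
    ae_lintegral_sq_read_le E hR m ((j : ℝ) * E.refresh (m + 1)) (fun τ => ((j : ℝ) * E.refresh (m + 1)) + (σ₁ + τ) / E.a (m + 1)) hslice hC
  refine ⟨?_, ?_, ⟨C, hsq⟩, lintegral_carrier_lt_top_of_bound hCB, lintegral_mul_lt_top_of_bound hCB hsq,
    Filter.Eventually.of_forall fun τ => hBtdiv τ, ?_, ?_⟩
  · -- measurability of the reading
    exact aestronglyMeasurable_stLift_read E hR m ((j : ℝ) * E.refresh (m + 1)) hθ hw.aestronglyMeasurable_uncurry
  · -- measurability of the carrier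
    have e : stLift Bt = uncurry Bt ∘ Prod.map id proj := by funext p; rfl
    rw [e]
    exact (hBt.comp (continuous_id.prodMap continuous_proj)).aestronglyMeasurable
  · -- a.e. weak solenoidality of the reading
    filter_upwards [hw.ae_isWeaklyDivFree_distort, hw.ae_memLp_two, ae_restrict_mem measurableSet_Ioo] with τ hdiv hm hτI
    have hcl := clamp_eq_of_mem_Ioo E m (r₀ := (j : ℝ) * E.refresh (m + 1)) hσ₁ hT hτI
    simp only [hcl] at hdiv
    exact isWeaklyDivFree_read E hR m ((j : ℝ) * E.refresh (m + 1)) (σ₁ + τ) hm hdiv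
  · -- THE WEAK IDENTITY
    intro Φ hΦ hΦdiv
    have hΦ1 : ContDiff ℝ 1 (stLift Φ) := hΦ.1.of_le (by exact_mod_cast le_top)
    -- the frame test and its admissibility
    have hΨL := isLipschitzSpaceTimeTest_frameTest E hR hF j hjt htR hσ₁ hT hΦ
    have hΨdiv := isDivFree_distort_frameTest E hR hF j hjt htR σ₁ (fun τ => hΦ.isSmooth_slice τ) hΦdiv
    have hFrame := hw.weak_eq _ hΨL hΨdiv
    simp only [zero_mul, add_zero] at hFrame ⊢
    -- (ii) the datum terms agree
    have hdatum : ∫ x, ⟪(φ ∘ E.X m ((j : ℝ) * E.refresh (m + 1)) (((j : ℝ) * E.refresh (m + 1)) + σ₁ / E.a (m + 1))) x, Φ 0 x⟫_ℝ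
        = ∫ y, ⟪φ y, Φ 0 (E.X m (((j : ℝ) * E.refresh (m + 1)) + max 0 (min σ₁ (E.a (m + 1) * (t - ((j : ℝ) * E.refresh (m + 1))))) / E.a (m + 1)) ((j : ℝ) * E.refresh (m + 1)) y)⟫_ℝ := by
      have hcl0 : max 0 (min σ₁ (E.a (m + 1) * (t - ((j : ℝ) * E.refresh (m + 1))))) = σ₁ := by
        rw [min_eq_left hσ₁T, max_eq_right hσ₁]
      rw [hcl0]
      have hg : AEStronglyMeasurable (fun x => ⟪(φ ∘ E.X m ((j : ℝ) * E.refresh (m + 1)) (((j : ℝ) * E.refresh (m + 1)) + σ₁ / E.a (m + 1))) x, Φ 0 x⟫_ℝ) volume :=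
        (hφ.1.comp_measurePreserving (hR.measurePreserving_X m ((j : ℝ) * E.refresh (m + 1)) _)).inner
          (hΦ.isSmooth_slice 0).continuous.aestronglyMeasurable
      rw [← integral_comp_X E hR m (((j : ℝ) * E.refresh (m + 1)) + σ₁ / E.a (m + 1)) ((j : ℝ) * E.refresh (m + 1)) hg]
      refine integral_congr_ae (Filter.Eventually.of_forall fun y => ?_)
      simp only [Function.comp_apply, hXX]
    -- (i) the bulk terms agree for a.e. `τ`
    have hbulk : (fun τ => ∫ x, ⟪w τ (E.X m ((j : ℝ) * E.refresh (m + 1)) (((j : ℝ) * E.refresh (m + 1)) + (σ₁ + τ) / E.a (m + 1)) x),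
          Torus.timeDeriv Φ τ x + Torus.convect (Bt τ) (Φ τ) x + FluidPDE.Torus.viscAdj 𝔸c (Φ τ) x⟫_ℝ)
        =ᵐ[volume.restrict (Ioo 0 T)] fun τ => ∫ y, ⟪w τ y,
          Torus.timeDeriv (fun τ' y => Φ τ' (E.X m (((j : ℝ) * E.refresh (m + 1)) + max 0 (min (σ₁ + τ') (E.a (m + 1) * (t - ((j : ℝ) * E.refresh (m + 1))))) / E.a (m + 1)) ((j : ℝ) * E.refresh (m + 1)) y)) τ y +
          Torus.convect (bc (σ₁ + τ))
            (fun y => Φ τ (E.X m (((j : ℝ) * E.refresh (m + 1)) + max 0 (min (σ₁ + τ) (E.a (m + 1) * (t - ((j : ℝ) * E.refresh (m + 1))))) / E.a (m + 1)) ((j : ℝ) * E.refresh (m + 1)) y)) y +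
          FluidPDE.Torus.viscAdjVar (fun y => FluidPDE.Torus.Visc4.conj
            (frameG E m (((j : ℝ) * E.refresh (m + 1)) + max 0 (min (σ₁ + τ) (E.a (m + 1) * (t - ((j : ℝ) * E.refresh (m + 1))))) / E.a (m + 1)) ((j : ℝ) * E.refresh (m + 1)) y) 𝔸c)
            (fun y => Φ τ (E.X m (((j : ℝ) * E.refresh (m + 1)) + max 0 (min (σ₁ + τ) (E.a (m + 1) * (t - ((j : ℝ) * E.refresh (m + 1))))) / E.a (m + 1)) ((j : ℝ) * E.refresh (m + 1)) y)) y⟫_ℝ := by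
      filter_upwards [hslice, ae_restrict_mem measurableSet_Ioo] with τ hwτ hτI
      have hcl := clamp_eq_of_mem_Ioo E m (r₀ := (j : ℝ) * E.refresh (m + 1)) hσ₁ hT hτI
      -- the time derivative BEFORE rewriting the clamp (it is a derivative in `τ`)
      have htd := fun y => timeDeriv_frameTest E hR hF (r₀ := (j : ℝ) * E.refresh (m + 1)) hσ₁ hT hΦ1 hτI y
      simp only [htd, hcl]
      -- abbreviations
      set t' : ℝ := ((j : ℝ) * E.refresh (m + 1)) + (σ₁ + τ) / E.a (m + 1) with ht'
      have hu' : (σ₁ + τ) / E.a (m + 1) ∈ Icc 0 (t - ((j : ℝ) * E.refresh (m + 1))) := by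
        refine ⟨div_nonneg (by linarith [hτI.1]) ha.le, ?_⟩
        rw [div_le_iff₀ ha]
        have h2 := hτI.2; rw [hT] at h2
        linarith [mul_comm (E.a (m + 1)) (t - ((j : ℝ) * E.refresh (m + 1)))]
      -- the Eulerian integrand, composed with the forward map, is the frame integrand
      have hEi_meas : AEStronglyMeasurable (fun x => ⟪w τ (E.X m ((j : ℝ) * E.refresh (m + 1)) t' x),
          Torus.timeDeriv Φ τ x + Torus.convect (Bt τ) (Φ τ) x + FluidPDE.Torus.viscAdj 𝔸c (Φ τ) x⟫_ℝ) volume := by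
        refine (hwτ.comp_measurePreserving (hR.measurePreserving_X m ((j : ℝ) * E.refresh (m + 1)) t')).inner ?_
        refine Continuous.aestronglyMeasurable ?_
        refine ((?_ : Continuous fun x => Torus.timeDeriv Φ τ x).add ?_).add ?_
        · exact (hΦ.timeDeriv.isSmooth_slice τ).continuous
        · have hBτ : Continuous (Bt τ) := hBt.comp (continuous_const.prodMk continuous_id)
          have h : lift (Torus.convect (Bt τ) (Φ τ)) = fun y => fderiv ℝ (lift (Φ τ)) y (lift (Bt τ) y) := by
            funext y; rw [lift_apply, Torus.convect, ← fderiv_lift, lift_apply]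
          rw [← continuous_lift_iff, h]
          exact ((hΦ.isSmooth_slice τ).continuous_fderiv (by simp)).clm_apply (continuous_lift_iff.2 hBτ)
        · exact (FluidPDE.Torus.isSmooth_viscAdj 𝔸c (hΦ.isSmooth_slice τ)).continuous
      rw [← integral_comp_X E hR m t' ((j : ℝ) * E.refresh (m + 1)) hEi_meas]
      refine integral_congr_ae (Filter.Eventually.of_forall fun y => ?_)
      -- pointwise at the label `y`
      simp only [hXX]
      congr 1
      rw [convect_comp_X E hR m t' ((j : ℝ) * E.refresh (m + 1)) (hΦ.isSmooth_slice τ) (bc (σ₁ + τ)) y, hRB τ hτI y, map_sub, map_smul,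
        viscAdjVar_conj_frameG_closed E hR hF j (T := t - ((j : ℝ) * E.refresh (m + 1))) (by linarith) hu' 𝔸c (hΦ.isSmooth_slice τ) y]
      unfold Torus.convect
      abel
    rw [integral_congr_ae hbulk, hdatum]
    exact hFrame

end Summit.AnomalousDissipation.AnomalousDissipation.Theorems.SolenoidalFractalHomogenisation.LagrangianStep.FrameConj

end
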